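import Summits.BirchSwinnertonDyer.BirchSwinnertonDyer.Theses.PrintCf2RubinValueTwo
import HarnessLib

/-!
# Route-C glue `KatzDistributionsAtTwoJZeroClassOneOfSplitPrints` (rev 35, stmt-BirchSwinnertonDyer-33979) BY NAME — modus ponens

Cell `bsd-print-cf2`, width seat `bsd-line-cf2c-w4` g17 (planner g24 turnkey T2); `--workitem stmt-BirchSwinnertonDyer-33979`.  The glue of the
PRINTS SPLIT of the leaf 30221 `KatzDistributionsAtTwoJZeroClassOne`: print leaf `PrintsKatzJZeroClassOneTwo` (33977) → OfPrints twin
`KatzDistributionsAtTwoJZeroClassOneOfPrints` (33978) → 30221; the glue is `fun h1 h2 ↦ h2 h1`.  HONEST FRAMING: pure logic; nothing about the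
six de Shalit prints or the measure is proved here; no summit statement is proved; BSD is not proved by any of this.
References: [deShalit1987] II Thm. 4.14 (36) (p. 71), II.4.17 (54) (p. 78).
-/

set_option autoImplicit false
set_option linter.dupNamespace false

noncomputable section

namespace Summit.BirchSwinnertonDyer.BirchSwinnertonDyer.Theorems.PrintCf2.KatzMeasureJZeroTop

/-- **`KatzDistributionsAtTwoJZeroClassOneOfSplitPrints` BY NAME** (`leaf → (leaf → 30221) → 30221`). [cite: deShalit1987, II Thm. 4.14 (36) (p. 71)] -/
theorem katzDistributionsAtTwoJZeroClassOneOfSplitPrints_holds :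
    Summit.BirchSwinnertonDyer.BirchSwinnertonDyer.Theses.PrintCf2RubinValueTwo.KatzDistributionsAtTwoJZeroClassOneOfSplitPrints :=
  fun h1 h2 ↦ h2 h1

end Summit.BirchSwinnertonDyer.BirchSwinnertonDyer.Theorems.PrintCf2.KatzMeasureJZeroTop

end
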